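import Mathlib
import HarnessLib
import HarnessLib.Audit
import Summits.CriticalPhenomena.Statement
import Literature.Probability.RandomPlanarGeometry.ChordalCurveFamily
import Literature.Probability.RandomPlanarGeometry.LoopSpaceMaps
import Summits.CriticalPhenomena.SAWScalingLimit.Theorems.SAWLoopFugacityFlowAvoidanceDeterminesLaw
import Summits.CriticalPhenomena.SAWScalingLimit.Theorems.SAWPoissonBanksLSWSimpleRestrictionIsSLE
import HarnessLib.Audit.Status.Attr

/-!
Route: SAWRestrictionRigidity

It suffices to show X5 = (R*) ∧ (L) [restriction–Markov rigidity + lattice-exact axioms; idea card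
restriction-markov-rigidity]:
 (R*) Rigidity (continuum, no conformal structure assumed): every chordal curve family P on
Dobrushin domains that
      (i) is chordal and carried by simple curves meeting ∂D only at a, b; (ii) has the two-sided
restriction property
      (Literature.Probability.RandomPlanarGeometry.ChordalFamily.IsRestriction); (iii) has the
RESTRICTION-COUPLED domain Markov
      property: a Markov extension Q (ChordalFamily.IsMarkovExtension) whose conditioning to every
Jordan subdomain D' of the
      remaining slit domain with D'.pt 0 = tip is P D' itself ("the future is the same model in the
slit domain"); (iv) is
      reversible (P (D; b, a) = reverse_* P (D; a, b)); (v) is covariant under the lattice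
similarity group z ↦ r·i^k·z + w
      (r > 0, k ∈ ℕ, w ∈ ℂ) and under complex conjugation — IS conformally covariant
(ChordalFamily.IsConformallyCovariant).
      The Euclidean quarter-turn is the only embedding-specific datum; conformal invariance is
OUTPUT.
 (L)  Lattice side: the critical δℤ² SAW laws have a full scaling limit P (LimitExists: ∃ P chordal
with (lim) for every
      Dobrushin domain and EVERY endpoint approximation), and every such P inherits (i)–(v) from
identities that are EXACT at
      each mesh (AxiomsOfLimit): restriction (LSW04 §3.4.5), Markov (conditional future = SAW of the
slit graph), reversal,
      D4 and — through the full-filter limit — dilations ((λΩ)_δ = λ·Ω_{δ/λ}) and all translations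
(axis-parallel w ∈ δ_nℤ²
      along δ_n = |w|/n, then compose).
Then the support LSWRestrictionFact83 (LSW03 at κ = 8/3, hypothesis-free: chordal + conformally
covariant + restriction +
simple ⟹ every P D is the chordal SLE_{8/3} law,
Literature.Probability.RandomPlanarGeometry.IsSLELaw (8/3); SLE_{8/3} existence and
uniqueness in law are library THEOREMS, so no named fact rides along) identifies the limit, and
(lim) becomes
Literature.Probability.RandomPlanarGeometry.ConvergesInLawToSLE (8/3), i.e. SAWScalingLimit. This
last step is the route's deciding
theorem `closes : Rigidity → AxiomsOfLimit → LimitExists → LSWRestrictionFact83 → SAWScalingLimit`,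
PROVED in the route file (rev 1)
and restated verbatim as the Assembly item.

Lean (X5 = Rigidity ∧ LimitExists ∧ AxiomsOfLimit; each conjunct is a decl of the route file and
elaborates with imports
Literature.Probability.RandomPlanarGeometry.ChordalCurveFamily,
Literature.Probability.RandomPlanarGeometry.LoopSpaceMaps):
 Rigidity := ∀ P : ChordalFamily, P.IsChordal → P.IsRestriction → (∃ Q, P.IsMarkovExtension Q ∧ ∀ D
p D', D'.carrier ⊆ remainingDomain D p →
   D'.pt 0 = p.target → D'.pt 1 = D.pt 1 → ∀ T, MeasurableSet T → P D' T * Q D p (rangeSubset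
(closure D'.carrier)) = Q D p (T ∩ rangeSubset (closure D'.carrier)))
   → (reversible) → (covariant under similarity (r·I^k) w) → (covariant under conjLIE) → (∀ D, ∀ᵐ γ
∂P D, γ ∈ simple ∧ γ.range ∩ frontier D ⊆ {a, b})
   → P.IsConformallyCovariant;
 LimitExists := ∃ P : ChordalFamily, P.IsChordal ∧ ∀ D a b, SAW.IsEndpointApprox D a b → TendstoLaw
(fun δ γ => γ.curve) (fun δ => SAW.law D.carrier δ (a δ) (b δ)) id (P D);
 AxiomsOfLimit := ∀ P, P.IsChordal → (lim) → P.IsRestriction ∧ (iii) ∧ (iv) ∧ (v) ∧ (i).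

Rationale: WHY THIS LINE. LSW03 (LawlerSchrammWerner2003Restriction, arXiv:math/0209343) classify restriction
measures ASSUMING conformal
invariance; LSW04 (LawlerSchrammWerner2004SAW) note that restriction, reversal and the Markov
structure of the x_c-weighted SAW are
exact finite identities, and that "we do not know how to prove … that [the limit] is conformally
covariant". Beffara2008Universal
(Prop. 4, §2.2) shows the only freedom a blind rescaling argument leaves is a linear modulus, pinned
by an order-4 lattice rotation.
The card's conjecture R* welds these: exact restriction + (restriction-coupled) domain Markov +
reversibility + translations +
dilations should leave at most the linear modulus, and the quarter-turn of ℤ² spends it — conformal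
invariance with no observable,
no integrability, no random-walk comparison. Imported area: conformal-restriction technology (hull
semigroups, LSW martingales run
with similarities only, Beltrami rigidity) for R*; weak-convergence bookkeeping on CurveClass for
the lattice side.
DESIGN POINTS. (a) The tree's bare IsDomainMarkov is (nearly) vacuous on simple boundary-avoiding
families (its `domain` clause
never fires: the remaining slit domain determines (D, past)); without a conformal structure the
Markov axiom has content only
COUPLED TO RESTRICTION: the conditional future, conditioned into any Jordan subdomain of the slit
domain, is P there. This is the
exact lattice identity and is what Rigidity assumes. (b) Cheap exotics are dead by design (card +
retired siblings -bp/ -c0/affine):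
linear images L_*SLE_{8/3} keep every axiom but the quarter-turn unless L is conformal; b-normalised
pullbacks by z|z|^s fail
reversibility; e^{-s·natural length} tilts (arXiv:1211.4146) fail dilations; Dirac/deterministic
families fail restriction +
boundary avoidance (pinch ∂D' onto the curve). (c) Translation/dilation covariance of the FULL limit
is exact lattice algebra, so
no continuity-in-D hypothesis is put into R*.
RANKED CRUXES. r2 Rigidity (R*, D4 form; new mathematics, hardest, most informative — its refutation
by an explicit anisotropic
restriction–Markov family would itself be major negative knowledge). r3 AvoidanceCocycleLimit
(value-free: P_δ(γ ⊆ cl D') =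
Z_δ(D')/Z_δ(D) converges along δ → 0+ for D' ⊆ D agreeing near a, b; the one extra scalar lattice
input, engine of uniqueness of
subsequential limits and hence of dilation covariance; concrete and attackable). r4 AxiomsOfLimit
(exact identities pass to the
limit; the Markov passage needs slit-domain stability). r5 LimitExists (∃ full limit for all
domains/approximations; tightness only
eventual). Supports: EventualTight (∃δ₀ form of the refuted stmt-0772), AvoidanceDeterminesLaw (a
law on simple boundary-avoiding
chords is determined by sub-domain avoidance probabilities; LSW03 §3 analogue), LSWRestrictionFact83
(LSW03 classification at
κ = 8/3, hypothesis-free: SLE_{8/3} existence / uniqueness in law are the library theorems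
exists_isSLECurve_eightThirds /
IsSLECurve.map_eq_holds; the hypothesis-laden LSWRestrictionFact = stmt-0775 of route
SAWConfRestriction, whose signature carries the
unproved all-κ fact exists_isSLECurve (⇔ the SLE₈ trace theorem), was dropped from this route at rev
1, as was the logical item
ClosingChain). Assembly = the type of the deciding theorem `closes`, PROVED sorry-free in the route
file at rev 1:
Rigidity → AxiomsOfLimit → LimitExists → LSWRestrictionFact83 → SAWScalingLimit (P from LimitExists;
AxiomsOfLimit gives the axioms;
Rigidity gives IsConformallyCovariant; LSWRestrictionFact83 gives IsSLELaw (8/3) D (P D);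
SAW.aemeasurable_curve + integral_map);
the route's used-constants cone (106 project constants) now has no unproved Literature fact, so the
route is staffable. No separate Target decl: X5 is literally the
conjunction of three cruxes (avoids signature drift under repair).
KILL CRITERIA. ¬Rigidity by a family the SAW limit could be (all axioms incl. quarter-turn, not
conformal) closes the route
refuted; a witness violating an axiom the SAW provably has ⇒ restate with that axiom.
¬AvoidanceCocycleLimit (oscillating ratios)
kills the uniqueness engine (pivot: run Rigidity on subsequential limit families).
Approximation-dependence of the limit
(¬EndpointRobust of route SAWConfRestriction) refutes the conjunct as typed, not just this route.
NOT DECOMPOSED YET (tenure, glued splits ≤ 3): LimitExists ↦ {EventualTight ∧ simple subsequential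
limits, uniqueness from r3 +
AvoidanceDeterminesLaw, diagonal extraction}; AxiomsOfLimit ↦ {restriction+reversal+covariance
passage, Markov passage, simplicity};
Rigidity ↦ {pushforward/tilt classification (the linear-modulus theorem), exclusion of
non-pushforward solutions}. Definition
requests filed: ChordalFamily.IsRestrictionMarkov, .IsReversible, .IsLatticeSimilarityCovariant,
SAW.IsScalingLimitFamily.
CHEAPEST FALSIFIER. For R*: push the catalogued cheap exotics through axioms (i)–(v) exactly as
typed (restriction-COUPLED Markov
clause included) — linear images L_*SLE_{8/3} with L not conformal (must fail only the quarter-turn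
clause of (v)),
e^{-s·natural length} tilts of SLE_{8/3} (arXiv:1211.4146; must fail dilations), b-normalised
|z|^s-pullbacks (must fail
reversibility / translations); any one of them passing all five refutes Rigidity as typed within a
refuter session. For (L): a
transfer-matrix evaluation at x_c of Z_δ(D')/Z_δ(D) for nested lattice rectangles agreeing near the
marked corners (strip widths
≤ 12) showing no stabilisation in δ kills AvoidanceCocycleLimit (r3) and with it the uniqueness
engine behind LimitExists.
Sources: LawlerSchrammWerner2003Restriction, LawlerSchrammWerner2004SAW, Beffara2008Universal,
Werner2007, Schramm2000,
KennedyLawler2013, DKKMO2020Rotational, KemppainenSmirnov2017, DuminilCopinHammond2013,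
arXiv:math/0307353, arXiv:1211.4146,
arXiv:1008.4321, doi:10.1007/s00220-003-0956-8, doi:10.1007/s00220-020-03697-1.

Novelty: NOVELTY (search-before-claim, this session: `lit search --hybrid "restriction property domain Markov
… without conformal invariance"` 12 local docs (only Lawler2005ConformallyInvariant relevant); `lit
vsearch` of R* in prose (12, nothing CI-free); `lit frontier CriticalPhenomena --since 2020` (30
descendants, none on restriction/Markov rigidity); `lit galaxy search --star all "restriction
property without conformal invariance"` and `--star pdf "domain Markov property and the restriction
property"` (0 hits); crossref "restriction property Markov property SLE characterization without
conformal invariance" (15: Werner ECM survey doi:10.4171/009-1/31, Wu 2020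
doi:10.1007/s00220-020-03697-1 hypergeometric-SLE conformal-Markov characterisation,
Friedrich–Werner doi:10.1007/s00220-003-0956-8 — all ASSUME conformal invariance); zbMATH 0; plus
the card's own searches and the refuter novelty audit of 2026-08-15 (grade new-mechanism).
Nearest prior art: LawlerSchrammWerner2003Restriction (arXiv:math/0209343: restriction measures
classified with conformal invariance built into the definition via Φ_A; only α = 5/8 on simple
curves); LawlerSchrammWerner2004SAW (arXiv:math/0204277 §3.4.5, Prediction 1: lattice restriction
identity; conformal covariance of the limit left open); Beffara2008Universal (arXiv:0708.3908 Prop.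
4, §2.2: linear deformation ⇒ linear image, an order-4 graph rotation pins the modulus) = tree
barrier EmbeddingModulusUniqueness; Schramm2000 / Werner2007 §3.2 (conformal M  [refs: 10.4171/009-1/31, 10.1007/s00220-020-03697-1, 10.1007/s00220-003-0956-8, math/0209343, math/0204277, 0708.3908, 2012.11672, math/0307353, doi:10.4171/009-1/31, doi:10.1007/s00220-020-03697-1, doi:10.1007/s00220-003-0956-8, Schramm2000, Werner2007]

Barriers (technique_class: restriction-markov-rigidity symmetry-upgrade): technique_class: restriction-markov-rigidity symmetry-upgrade
- Literature.Barriers.CriticalPhenomena.ScaleCovarianceNotMoebius [scale-implies-conformal,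
symmetry-upgrade]: its witness (ScaleNotMoebius.witnessFamily, not_euclideanScaleUpgrade) is a d = 3
CORRELATION family with Euclidean + scale data only; Rigidity upgrades a planar CURVE family that in
addition carries exact two-sided restriction, the restriction-coupled domain Markov property and
reversibility — axioms outside the barrier's class, and exactly the ones claimed to rigidify (tilts
die by Markov + dilations, pullbacks by reversal + translations, linear images by the quarter-turn).
Honest reading: R* is still a symmetry-upgrade principle and could fail the same way; that failure
(an anisotropic restriction–Markov family with all lattice symmetries) is the route's first kill
criterion and would be recorded as a new barrier.
- Literature.Barriers.CriticalPhenomena.EmbeddingModulusUniqueness [embedding-independent …]: the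
line is deliberately NOT embedding-blind — on a sheared lattice L·ℤ² the same hypotheses hold with
the conjugated group L·D4·L⁻¹ and the expected conclusion is L_*SLE_{8/3}, consistent with
Beffara2008Universal Prop. 4; the Euclidean quarter-turn (k odd in z ↦ r·i^k·z + w) inside
Rigidity's hypothesis is the embedding-specific datum = the barrier's evasion (i) (as for
CardyRotToConfR2SymmetryUpgrade, whose hypothesis contains similarity covariance).
- Literature.Barriers.CriticalPhenomena.SAWNotKi

Novelty grade: new-mechanism — ROUTE REVIEW (refuter, 2026-08-15). All 8 decls elaborate (Probe2 rc0). NON-VACUOUS: Rigidity's hypotheses are satisfiable by chordal SLE_{8/3} modulo the named facts (strong Markov at σ_F for every closed F; slit tip = one prime end so the domain clause is consistent; restriction-coupling has conte (refuter refuter-rreview-route-NavierStokesRegula-42467265-0, 2026-08-15T12:18:20Z; prior: LawlerSchrammWerner2003Restriction (restriction classified WITHIN conformal invariance), LawlerSchrammWerner2004SAW §3.4.5 / Prediction 1 (lattice restriction + Markov exact; CI of the limit open), Beffara2008Universal Prop 4 / §2.2 (= barrier EmbeddingModulusUniqueness), Schramm2000 / Werner2007 §3.2 (conformal Markov characterisation),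 route-CriticalPhenomena-SAWConfRestriction (shares LSWRestri)

History (route lifecycle, newest last):
- 2026-08-15T16:17:10Z · rev 1: restated Assembly (stmt-CriticalPhenomena-1374) — route-repair (glue, D-0027 §2.1): deciding theorem `closes : Rigidity → AxiomsOfLimit → LimitExists → LSWRestrictionFact83 → SAWScalingLimit` PROVED (P from Lim (planner-rbadge-CriticalPhenomena-SAWRestrictio-01cec18f-g4-0)
- 2026-08-15T16:17:10Z · rev 1: dropped LSWRestrictionFact, ClosingChain — route-repair (glue, D-0027 §2.1): deciding theorem `closes : Rigidity → AxiomsOfLimit → LimitExists → LSWRestrictionFact83 → SAWScalingLimit` PROVED (P from Lim (planner-rbadge-CriticalPhenomena-SAWRestrictio-01cec18f-g4-0)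

sub-problem: SAWScalingLimit · status: open · opened planner-plancard-CriticalPhenomena-SAWScaling-e14df736-0 2026-08-15T10:55:06Z · rev 2 · ledger route-CriticalPhenomena-SAWRestrictionRigidity
GENERATED by the gate from the ledger (D-0016/17). Provers cite these decls: `theorem foo : Summit.CriticalPhenomena.SAWScalingLimit.Theses.SAWRestrictionRigidity.<Decl> := …` in Summits/CriticalPhenomena/SAWScalingLimit/Theorems/<Name>.lean.
-/

namespace Summit.CriticalPhenomena.SAWScalingLimit.Theses.SAWRestrictionRigidity

open scoped BigOperators Topology Manifold Classical MeasureTheory ProbabilityTheory Matrix InnerProductSpace ComplexConjugate ContinuousMap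
open Filter Set Function TopologicalSpace MeasureTheory

attribute [summit_statement] _root_.SAWScalingLimit

/-- item stmt-CriticalPhenomena-1368 · crux · rank 2 · open · by planner
why it might fail: No technique known; exotic (non-pushforward, non-tilt) restriction–Markov families may exist; a.e.-slack in the Markov kernel with no continuity-in-D hypothesis might admit choice-built monsters; fidelity of the tree's IsMarkovExtension (stopAt via representatives) untested beyond Dirac families.
sources: LawlerSchrammWerner2003Restriction, Beffara2008Universal, Werner2007, Schramm2000, arXiv:math/0307353, arXiv:1211.4146
[crux] R* (D4 form) of card restriction-markov-rigidity, continuum only, new mathematics: a chordal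
family on Dobrushin domains that is chordal, has two-sided restriction (IsRestriction), the
RESTRICTION-COUPLED domain Markov property (a Markov extension Q, ChordalFamily.IsMarkovExtension,
whose conditioning to every Jordan subdomain D' of the remaining slit domain with D'.pt 0 = tip is P
D'), is reversible (P (D;b,a) = reverse_* P (D;a,b)), is covariant under z ↦ r·i^k·z + w (r>0, k∈ℕ,
w∈ℂ) and under complex conjugation, and is carried by simple curves meeting ∂D only at a, b, is
conformally covariant (IsConformallyCovariant) — hence SLE_{8/3} by LSW03. Design: bare
IsDomainMarkov is vacuous on simple families (its `domain` clause never fires), so Markov is coupled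
to restriction. Sanity (card + retired siblings): L_*SLE_{8/3} passes all axioms but the
quarter-turn unless L conformal; b-normalised pullbacks by z|z|^s fail reversibility; e^{-s·natural
length} tilts (arXiv:1211.4146) fail dilations; Dirac families fail restriction + boundary
avoidance. Sources: LawlerSchrammWerner2003Restriction (arXiv:math/0209343 §1, §3),
Beffara2008Universal (arXiv:0708.3908 Prop 4, §2.2), Werner -/
@[route_item "route-CriticalPhenomena-SAWRestrictionRigidity", crux]
def Rigidity : Prop :=
  ∀ P : Literature.Probability.RandomPlanarGeometry.ChordalFamily, P.IsChordal → P.IsRestriction → (∃ Q : Literature.Probability.RandomPlanarGeometry.DobrushinDomain → Literature.Probability.RandomPlanarGeometry.CurveClass ℂ → MeasureTheory.Measure (Literature.Probability.RandomPlanarGeometry.CurveClass ℂ), P.IsMarkovExtension Q ∧ ∀ (D : Literature.Probability.RandomPlanarGeometry.DobrushinDomain) (p : Literature.Probability.RandomPlanarGeometry.CurveClass ℂ) (D' : Literature.Probability.RandomPlanarGeometry.DobrushinDomain), D'.carrier ⊆ Literature.Probability.RandomPlanarGeometry.remainingDomain D p → D'.pt 0 = p.target → D'.pt 1 = D.pt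 1 → ∀ T : Set (Literature.Probability.RandomPlanarGeometry.CurveClass ℂ), MeasurableSet T → P D' T * Q D p (Literature.Probability.RandomPlanarGeometry.CurveClass.rangeSubset (closure D'.carrier)) = Q D p (T ∩ Literature.Probability.RandomPlanarGeometry.CurveClass.rangeSubset (closure D'.carrier))) → (∀ D D' : Literature.Probability.RandomPlanarGeometry.DobrushinDomain, D'.carrier = D.carrier → D'.pt 0 = D.pt 1 → D'.pt 1 = D.pt 0 → P D' = (P D).map Literature.Probability.RandomPlanarGeometry.CurveClass.reverse) → (∀ (D : Literature.Probability.RandomPlanarGeometry.DobrushinDomain) (c : ℂ) (hc : c ≠ 0) (w : ℂ), (∃ (r : ℝ) (k : ℕ), 0 < r ∧ c = (r : ℂ) * Complex.I ^ k) → P (D.map (Literature.Probability.RandomPlanarGeometry.similarity c hc w)) = (P D).map (Literature.Probability.RandomPlanarGeometry.CurveClass.map (Literature.Probability.RandomPlanarGeometry.similarity c hc w : C(ℂ, ℂ)))) → (∀ D : Literature.Probability.RandomPlanarGeometry.DobrushinDomain, P (D.map Complex.conjLIE.toHomeomorph) = (P D).map (Literature.Probability.RandomPlanarGeometry.CurveClass.map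 (Complex.conjLIE.toHomeomorph : C(ℂ, ℂ)))) → (∀ D : Literature.Probability.RandomPlanarGeometry.DobrushinDomain, ∀ᵐ γ ∂(P D), γ ∈ Literature.Probability.RandomPlanarGeometry.CurveClass.simple ∧ γ.range ∩ frontier D.carrier ⊆ {D.pt 0, D.pt 1}) → P.IsConformallyCovariant

/-- item stmt-CriticalPhenomena-1369 · crux · rank 3 · open · by planner
why it might fail: Full-filter limit of a ratio of SAW generating functions with no monotonicity in δ — as hard as uniqueness of a scalar scaling limit; boundary lattice factors (Kennedy–Lawler) cancel only because D, D' agree near a, b; even existence (not just the conformal value) is not in print.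
sources: LawlerSchrammWerner2004SAW, KennedyLawler2013, arXiv:1008.4321
[crux] the one extra (value-free) scalar lattice input of the card (its r3): for Dobrushin D' ⊆ D
with the same marked points and agreeing with D near a and b, and any endpoint approximation, the
critical SAW probability P_δ(curve ⊆ closure D') (= Z_δ(D')/Z_δ(D) up to largest-component
bookkeeping) converges as δ → 0+ along the FULL filter to some c ∈ [0,1] (no claim on the value;
LSW04 Prediction: a conformal quantity to the power 5/8). With AvoidanceDeterminesLaw it makes
subsequential curve limits unique, hence gives the full limit (LimitExists) and its dilation
covariance. Sources: LawlerSchrammWerner2004SAW (arXiv:math/0204277 §3.4.2–3.4.5, §4.1),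
KennedyLawler2013 (arXiv:1109.3091 §1), arXiv:1008.4321 §3.1. -/
@[route_item "route-CriticalPhenomena-SAWRestrictionRigidity", crux]
def AvoidanceCocycleLimit : Prop :=
  ∀ (D D' : Literature.Probability.RandomPlanarGeometry.DobrushinDomain) (a b : ℝ → Literature.Probability.LatticeModels.Site 2), Literature.Probability.RandomPlanarGeometry.SAW.IsEndpointApprox D a b → D'.carrier ⊆ D.carrier → D'.pt 0 = D.pt 0 → D'.pt 1 = D.pt 1 → (∃ ε : ℝ, 0 < ε ∧ D'.carrier ∩ Metric.ball (D.pt 0) ε = D.carrier ∩ Metric.ball (D.pt 0) ε ∧ D'.carrier ∩ Metric.ball (D.pt 1) ε = D.carrier ∩ Metric.ball (D.pt 1) ε) → ∃ c : ENNReal, Filter.Tendsto (fun δ => (((Literature.Probability.RandomPlanarGeometry.SAW.law D.carrier δ (a δ) (b δ)).map (fun γ => γ.curve)) (Literature.Probability.RandomPlanarGeometry.CurveClass.rangeSubset (closure D'.carrier)))) (nhdsWithin 0 (Set.Ioi 0)) (nhds c)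

/-- item stmt-CriticalPhenomena-1370 · crux · rank 4 · open · by planner
why it might fail: Markov passage needs stability of SAW limits in slit domains perturbed near the tip (beyond (lim) on Jordan domains); simplicity/boundary avoidance need no-crawling estimates not in print; restriction passage needs null touching; largest-component bookkeeping (cf. notes on stmt-0773).
sources: LawlerSchrammWerner2004SAW, Werner2007, KennedyLawler2013, DuminilCopinHammond2013
[crux] every chordal family P that is the full scaling limit (lim) of the critical δℤ² SAW laws —
for every Dobrushin domain and EVERY endpoint approximation (SAW.IsEndpointApprox) — satisfies the
hypotheses of Rigidity: restriction (exact lattice identity, LSW04 §3.4.5; portmanteau on the closed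
event range ⊆ closure D' plus null touching), restriction-coupled Markov (conditional future given a
lattice past = SAW of the slit graph; its conditioning into a Jordan subdomain = SAW there),
reversibility (exact), covariance under z ↦ r·i^k·z + w and conjugation (quarter-turn/conjugation
exact at each δ; dilations via (λΩ)_δ = λ·Ω_{δ/λ} and the full-filter limit; translations:
axis-parallel w lies in δ_nℤ² along δ_n = |w|/n, then compose — no continuity in D needed),
simplicity and boundary avoidance. Sources: LawlerSchrammWerner2004SAW (arXiv:math/0204277 §3.4.5,
p.14), Werner2007 §3.2, KennedyLawler2013, DuminilCopinHammond2013. -/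
@[route_item "route-CriticalPhenomena-SAWRestrictionRigidity", crux]
def AxiomsOfLimit : Prop :=
  ∀ P : Literature.Probability.RandomPlanarGeometry.ChordalFamily, P.IsChordal → (∀ (D : Literature.Probability.RandomPlanarGeometry.DobrushinDomain) (a b : ℝ → Literature.Probability.LatticeModels.Site 2), Literature.Probability.RandomPlanarGeometry.SAW.IsEndpointApprox D a b → Literature.Probability.RandomPlanarGeometry.TendstoLaw (fun δ (γ : Literature.Probability.RandomPlanarGeometry.SAW.DomainSAW D.carrier δ (a δ) (b δ)) => γ.curve) (fun δ => Literature.Probability.RandomPlanarGeometry.SAW.law D.carrier δ (a δ) (b δ)) id (P D)) → P.IsRestriction ∧ (∃ Q : Literature.Probability.RandomPlanarGeometry.DobrushinDomain → Literature.Probability.RandomPlanarGeometry.CurveClass ℂ → MeasureTheory.Measure (Literature.Probability.RandomPlanarGeometry.CurveClass ℂ), P.IsMarkovExtension Q ∧ ∀ (D : Literature.Probability.RandomPlanarGeometry.DobrushinDomain) (p : Literature.Probability.RandomPlanarGeometry.CurveClass ℂ) (D' : Literature.Probability.RandomPlanarGeometry.DobrushinDomain), D'.carrier ⊆ Literature.Probability.RandomPlanarGeometry.remainingDomain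 D p → D'.pt 0 = p.target → D'.pt 1 = D.pt 1 → ∀ T : Set (Literature.Probability.RandomPlanarGeometry.CurveClass ℂ), MeasurableSet T → P D' T * Q D p (Literature.Probability.RandomPlanarGeometry.CurveClass.rangeSubset (closure D'.carrier)) = Q D p (T ∩ Literature.Probability.RandomPlanarGeometry.CurveClass.rangeSubset (closure D'.carrier))) ∧ (∀ D D' : Literature.Probability.RandomPlanarGeometry.DobrushinDomain, D'.carrier = D.carrier → D'.pt 0 = D.pt 1 → D'.pt 1 = D.pt 0 → P D' = (P D).map Literature.Probability.RandomPlanarGeometry.CurveClass.reverse) ∧ (∀ (D : Literature.Probability.RandomPlanarGeometry.DobrushinDomain) (c : ℂ) (hc : c ≠ 0) (w : ℂ), (∃ (r : ℝ) (k : ℕ), 0 < r ∧ c = (r : ℂ) * Complex.I ^ k) → P (D.map (Literature.Probability.RandomPlanarGeometry.similarity c hc w)) = (P D).map (Literature.Probability.RandomPlanarGeometry.CurveClass.map (Literature.Probability.RandomPlanarGeometry.similarity c hc w : C(ℂ, ℂ)))) ∧ (∀ D : Literature.Probability.RandomPlanarGeometry.DobrushinDomain, P (D.map Complex.conjLIE.toHomeomorph)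 = (P D).map (Literature.Probability.RandomPlanarGeometry.CurveClass.map (Complex.conjLIE.toHomeomorph : C(ℂ, ℂ)))) ∧ (∀ D : Literature.Probability.RandomPlanarGeometry.DobrushinDomain, ∀ᵐ γ ∂(P D), γ ∈ Literature.Probability.RandomPlanarGeometry.CurveClass.simple ∧ γ.range ∩ frontier D.carrier ⊆ {D.pt 0, D.pt 1})

/-- item stmt-CriticalPhenomena-1371 · crux · rank 5 · open · by planner
why it might fail: Eventual tightness of critical SAW is open (no annulus-crossing bound at x_c); uniqueness rests on AvoidanceCocycleLimit; an approximation-dependent limit (boundary lattice effects, Kennedy–Lawler) would refute the conjunct SAWScalingLimit itself as typed.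
sources: LawlerSchrammWerner2004SAW, KemppainenSmirnov2017, AizenmanBurchardDuke1999, DuminilCopinHammond2013, KennedyLawler2013
[crux] existence of the full scaling limit of the critical δℤ² SAW as a chordal curve family: ∃ P,
P.IsChordal ∧ (lim) for every Dobrushin domain and every endpoint approximation (the limit is NOT
identified here). Planned glued split (tenure): EventualTight ∧ simple boundary-avoiding
subsequential limits; uniqueness of subsequential limits from AvoidanceCocycleLimit +
AvoidanceDeterminesLaw; diagonal extraction over a countable dense class of domains. Sources:
LawlerSchrammWerner2004SAW (arXiv:math/0204277 p.3 'we do not know how to prove the existence of the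
limit'), KemppainenSmirnov2017 (arXiv:1212.6215 Thm 1.5), AizenmanBurchardDuke1999,
DuminilCopinHammond2013 (arXiv:1205.0401). -/
@[route_item "route-CriticalPhenomena-SAWRestrictionRigidity", crux]
def LimitExists : Prop :=
  ∃ P : Literature.Probability.RandomPlanarGeometry.ChordalFamily, P.IsChordal ∧ (∀ (D : Literature.Probability.RandomPlanarGeometry.DobrushinDomain) (a b : ℝ → Literature.Probability.LatticeModels.Site 2), Literature.Probability.RandomPlanarGeometry.SAW.IsEndpointApprox D a b → Literature.Probability.RandomPlanarGeometry.TendstoLaw (fun δ (γ : Literature.Probability.RandomPlanarGeometry.SAW.DomainSAW D.carrier δ (a δ) (b δ)) => γ.curve) (fun δ => Literature.Probability.RandomPlanarGeometry.SAW.law D.carrier δ (a δ) (b δ)) id (P D))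

/-- item stmt-CriticalPhenomena-1372 · support · rank 9 · open · by planner
sources: KemppainenSmirnov2017, AizenmanBurchardDuke1999, DuminilCopinHammond2013
[support] eventual tightness of the pushed-forward critical SAW laws: for every Dobrushin domain and
endpoint approximation there is δ₀ > 0 such that {(law D δ a_δ b_δ).map curve : δ ∈ (0, δ₀]} is a
tight set of measures on CurveClass ℂ — the repaired (∃ δ₀) form of the refuted all-δ statement
stmt-CriticalPhenomena-0772 suggested by its refutation; child-designate of LimitExists, shared need
of every SAW route. Intended tools: Aizenman–Burchard / Kemppainen–Smirnov Condition G2 (an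
annulus-crossing bound at x_c not in print). Sources: KemppainenSmirnov2017 Thm 1.5,
AizenmanBurchardDuke1999, DuminilCopinHammond2013. -/
@[route_item "route-CriticalPhenomena-SAWRestrictionRigidity", crux]
def EventualTight : Prop :=
  ∀ (D : Literature.Probability.RandomPlanarGeometry.DobrushinDomain) (a b : ℝ → Literature.Probability.LatticeModels.Site 2), Literature.Probability.RandomPlanarGeometry.SAW.IsEndpointApprox D a b → ∃ δ₀ : ℝ, 0 < δ₀ ∧ MeasureTheory.IsTightMeasureSet ((fun δ => (Literature.Probability.RandomPlanarGeometry.SAW.law D.carrier δ (a δ) (b δ)).map (fun γ => γ.curve)) '' Set.Ioc 0 δ₀)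

/-- item stmt-CriticalPhenomena-1373 · support · rank 9 · closed · proved by Summit.CriticalPhenomena.SAWScalingLimit.Theorems.AvoidanceDeterminesLaw.AvoidanceDeterminesLaw_proof (prover) · by planner
sources: LawlerSchrammWerner2003Restriction, AizenmanBurchard1999
[support] avoidance determines the law: two probability measures on CurveClass ℂ carried by SIMPLE
chords of the Dobrushin domain D from a to b meeting ∂D only at a, b, which give the same mass to
{range ⊆ closure D'} for every Dobrushin D' ⊆ D with the same marked points and agreeing with D near
a and b (the form delivered by AvoidanceCocycleLimit), are equal (π-system of filled hull
complements generating the Borel sets of simple boundary-avoiding chords: a simple chord is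
determined by its range; Lusin–Souslin for γ ↦ range). Planar-topology/measure-theory analogue of
LSW03 §3 ('the law of K is determined by P[K ∩ A = ∅]'); used for uniqueness of subsequential SAW
limits and for uniqueness of the restriction extension to slit domains. Sources:
LawlerSchrammWerner2003Restriction §3, AizenmanBurchard1999 §2.1. -/
@[route_item "route-CriticalPhenomena-SAWRestrictionRigidity"]
def AvoidanceDeterminesLaw : Prop :=
  ∀ (D : Literature.Probability.RandomPlanarGeometry.DobrushinDomain) (μ ν : MeasureTheory.Measure (Literature.Probability.RandomPlanarGeometry.CurveClass ℂ)), MeasureTheory.IsProbabilityMeasure μ → MeasureTheory.IsProbabilityMeasure ν → (∀ᵐ γ ∂μ, γ ∈ Literature.Probability.RandomPlanarGeometry.CurveClass.simple ∧ γ.source = D.pt 0 ∧ γ.target = D.pt 1 ∧ γ.range ⊆ closure D.carrier ∧ γ.range ∩ frontier D.carrier ⊆ {D.pt 0, D.pt 1}) → (∀ᵐ γ ∂ν, γ ∈ Literature.Probability.RandomPlanarGeometry.CurveClass.simple ∧ γ.source = D.pt 0 ∧ γ.target = D.pt 1 ∧ γ.range ⊆ closure D.carrier ∧ γ.range ∩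 frontier D.carrier ⊆ {D.pt 0, D.pt 1}) → (∀ D' : Literature.Probability.RandomPlanarGeometry.DobrushinDomain, D'.carrier ⊆ D.carrier → D'.pt 0 = D.pt 0 → D'.pt 1 = D.pt 1 → (∃ ε : ℝ, 0 < ε ∧ D'.carrier ∩ Metric.ball (D.pt 0) ε = D.carrier ∩ Metric.ball (D.pt 0) ε ∧ D'.carrier ∩ Metric.ball (D.pt 1) ε = D.carrier ∩ Metric.ball (D.pt 1) ε) → μ (Literature.Probability.RandomPlanarGeometry.CurveClass.rangeSubset (closure D'.carrier)) = ν (Literature.Probability.RandomPlanarGeometry.CurveClass.rangeSubset (closure D'.carrier))) → μ = ν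

/-- `AvoidanceDeterminesLaw` holds: proved by `Summit.CriticalPhenomena.SAWScalingLimit.Theorems.AvoidanceDeterminesLaw.AvoidanceDeterminesLaw_proof`. -/
theorem AvoidanceDeterminesLaw_holds : AvoidanceDeterminesLaw := _root_.Summit.CriticalPhenomena.SAWScalingLimit.Theorems.AvoidanceDeterminesLaw.AvoidanceDeterminesLaw_proof

/-- item stmt-CriticalPhenomena-3017 · support · rank 9 · closed · proved by Summit.CriticalPhenomena.SAWScalingLimit.Theorems.LSWSimpleRestrictionIsSLE_proof @ db6b0749abc7 (prover) · by planner
[support] LSW03 classification in HYPOTHESIS-FREE form (route repair 2026-08-15; implies the shared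
item stmt-CriticalPhenomena-0775 = LSWRestrictionFact verbatim, see planner Sketch.lean
`lsw_new_implies_old`): a chordal family on Dobrushin domains that is chordal, conformally covariant
(ChordalFamily.IsConformallyCovariant), has the two-sided restriction property
(ChordalFamily.IsRestriction) and is carried by simple curves meeting ∂D only at the two marked
points is, in every domain, the chordal SLE_{8/3} law (IsSLELaw (8/3)). The named-fact hypotheses of
stmt-0775 are dropped because they are not needed at κ = 8/3: existence is the library THEOREM
Literature.Probability.RandomPlanarGeometry.exists_isSLECurve_eightThirds (SLEExistenceNeEightHolds;
Rohde–Schramm Thm 5.1 + Thm 7.1; axiom closure propext/choice/Quot.sound checked), uniqueness in law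
is IsSLECurve.map_eq_holds (SLEUniquenessInLaw); `exists_isSLECurve` for ALL κ is equivalent to the
unproved SLE₈ trace theorem (hasSLETrace_eight, SLETransienceIffTrace) and must not burden an
SLE_{8/3} route. Sources: LawlerSchrammWerner2003Restriction (arXiv:math/0209343: p.5 results 1–2,
Prop. 3.3, Thm 6.1, Cor. 8.6), RohdeSchramm20 -/
@[route_item "route-CriticalPhenomena-SAWRestrictionRigidity", crux]
def LSWRestrictionFact83 : Prop :=
  ∀ P : Literature.Probability.RandomPlanarGeometry.ChordalFamily, P.IsChordal → P.IsConformallyCovariant → P.IsRestriction → (∀ D : Literature.Probability.RandomPlanarGeometry.DobrushinDomain, ∀ᵐ γ ∂(P D), γ ∈ Literature.Probability.RandomPlanarGeometry.CurveClass.simple ∧ γ.range ∩ frontier D.carrier ⊆ {D.pt 0, D.pt 1}) → ∀ D : Literature.Probability.RandomPlanarGeometry.DobrushinDomain, Literature.Probability.RandomPlanarGeometry.IsSLELaw ((8 : NNReal) / 3) D (P D)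

-- earlier Assembly (stmt-CriticalPhenomena-1374, replaced 2026-08-15T16:17:10Z -> stmt-CriticalPhenomena-10487): retired by None — Literature.Probability.RandomPlanarGeometry.exists_isSLECurve → Literature.Probability.RandomPlanarGeometry.IsSLECurve.map_eq → LSWRestrictionFact → Rigidity → LimitExists → AxiomsOfLimit → SAWScalingLimit
/-- item stmt-CriticalPhenomena-10487 · assembly · rank 1 · closed · proved by Summit.CriticalPhenomena.SAWScalingLimit.Theorems.sawRestrictionRigidity_assembly_proof (prover) · by planner
sources: LawlerSchrammWerner2003Restriction, LawlerSchrammWerner2004SAW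
[assembly] hypothesis-free closing chain Rigidity → AxiomsOfLimit → LimitExists →
LSWRestrictionFact83 → SAWScalingLimit (route repair 2026-08-15, replaces the `exists_isSLECurve →
IsSLECurve.map_eq → LSWRestrictionFact → …` form: the all-κ SLE existence fact exists_isSLECurve is
unproved (⇔ SLE₈ trace theorem) and unneeded at κ = 8/3, where existence is the library theorem
exists_isSLECurve_eightThirds and uniqueness in law is IsSLECurve.map_eq_holds). This is literally
the type of the route's deciding theorem `closes` (proved sorry-free in the route file: P from
LimitExists; AxiomsOfLimit gives restriction, restriction-coupled Markov, reversal,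
lattice-similarity + conjugation covariance, simplicity; Rigidity gives IsConformallyCovariant;
LSWRestrictionFact83 gives IsSLELaw (8/3) D (P D) = law of an SLE_{8/3} curve Γ;
SAW.aemeasurable_curve + integral_map turn TendstoLaw … id (P D) into ConvergesInLawToSLE (8/3)); a
Theorems file closes this item by `theorem assembly : Assembly := fun hR hA hL h83 => closes hR hA
hL h83`. Sources: LawlerSchrammWerner2003Restriction, LawlerSchrammWerner2004SAW. -/
@[route_item "route-CriticalPhenomena-SAWRestrictionRigidity"]
def Assembly : Prop :=
  Rigidity → AxiomsOfLimit → LimitExists → LSWRestrictionFact83 → SAWScalingLimit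

/-! D-0027 §2.1 — DECIDING THEOREM (planner-authored via `route open/edit --closes-file`; by planner-rbadge-CriticalPhenomena-SAWRestrictio-01cec18f-g4-0 2026-08-15T16:17:10Z):
its hypotheses are this route's items and its conclusion the sub-problem Statement (glue_lint), and it elaborates with this file. -/

@[closes "route-CriticalPhenomena-SAWRestrictionRigidity"] theorem closes : Rigidity → AxiomsOfLimit → LimitExists → LSWRestrictionFact83 → _root_.SAWScalingLimit := by
  -- The deciding theorem uses exactly the four load-bearing items: the full scaling limit `P` of the critical SAW
  -- laws exists (LimitExists); every such limit satisfies the lattice-exact axioms (AxiomsOfLimit); the axioms force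
  -- conformal covariance (Rigidity); LSW03 at κ = 8/3, hypothesis-free (LSWRestrictionFact83), identifies each `P D`
  -- as the chordal SLE_{8/3} law; `integral_map` turns `TendstoLaw … id (P D)` into convergence in law to an SLE curve.
  intro hR hA hL h83 D a b hab
  obtain ⟨P, hPch, hlim⟩ := hL
  obtain ⟨hres, hmk, hrev, hsim, hconj, hsimple⟩ := hA P hPch hlim
  have hcc : P.IsConformallyCovariant := hR P hPch hres hmk hrev hsim hconj hsimple
  obtain ⟨Γ, hΓ, hPD⟩ := h83 P hPch hcc hres hsimple D
  refine ⟨Γ, hΓ, Filter.Eventually.of_forall fun δ =>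
    Literature.Probability.RandomPlanarGeometry.SAW.aemeasurable_curve _ _ _ _, fun f => ?_⟩
  have key : ∫ γ, f γ ∂(P D) = ∫ ω, f (Γ ω) ∂Literature.Probability.Process.preWienerMeasure := by
    rw [hPD]
    exact MeasureTheory.integral_map hΓ.aemeasurable f.continuous.aestronglyMeasurable
  rw [← key]
  exact hlim D a b hab f

end Summit.CriticalPhenomena.SAWScalingLimit.Theses.SAWRestrictionRigidity
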